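import Mathlib.LinearAlgebra.FiniteDimensional.Lemmas
import Mathlib.LinearAlgebra.Matrix.Permanent
import Mathlib.Tactic.LinearCombination
import Literature.LinearAlgebra.Matrix.PermanentSubperm
import HarnessLib

/-!
# Alper–Bogart–Velasco, Cor. 1.4: linear spaces of `3 × 3` matrices with vanishing `2 × 2` subpermanents

Topic `Literature/Computability/AlgebraicComplexity`; fourth file of the proof of the named fact
`alperBogartVelasco2017_cor_1_4` (`AlperBogartVelasco.lean`).  J. Alper, T. Bogart, M. Velasco,
*A lower bound for the determinantal complexity of a hypersurface*, Found. Comput. Math. 17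
(2017), deduce `dc(perm_3) = 7` from their Thm. 1.2 and "`codim Sing(perm_3) = 6` … readily
computed (c.f. [von zur Gathen])" (arXiv:1505.02205, p. 3).  The proof of Thm. 1.2 only uses the
singular locus through a LINEAR subspace `V(I) ⊆ Sing(f)` of codimension `≤ m - 1`; for the
permanent, `Sing(perm_3)` is the set of matrices all of whose `2 × 2` subpermanents vanish.  This
file proves the corresponding elementary statement, which replaces the dimension count:

* `finrank_le_three_of_subperm_two_vanish`: a linear subspace `W` of `3 × 3` matrices over a field
  on which all nine `2 × 2` subpermanents vanish has `dim W ≤ 3` (`= 9 - 6`).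

Proof (no hypothesis on the field).  Filter `W` by the rows: `Y₂ = row₂(W)`,
`Y₁ = row₁ {x ∈ W : row₂ x = 0}`, `Y₀ = row₀ {x ∈ W : row₁ x = row₂ x = 0}`, so that
`dim W = dim Y₀ + dim Y₁ + dim Y₂` (rank–nullity, `finrank_eq_finrank_map_add_finrank_inf_ker`).
Polarising the quadrics `x_{pc} x_{qc'} + x_{pc'} x_{qc}` (vanishing on `W`) shows that the three
pairings `u_c v_{c'} + u_{c'} v_c` vanish for `u ∈ Y_p`, `v ∈ Y_q`, `p ≠ q`; and if `v ≠ 0`, say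
`v_{c₀} ≠ 0`, then `u ↦ u_{c₀}` is injective on `Y_p`, so `dim Y_p ≤ 1`
(`finrank_le_one_of_pairings`).  Hence at most one `Y_p` has dimension `≥ 2`, and then the others
vanish: `Σ dim Y_p ≤ 3`.

## References

* J. Alper, T. Bogart, M. Velasco, Found. Comput. Math. 17 (2017) 829–836,
  doi:10.1007/s10208-015-9300-x, arXiv:1505.02205 — Cor. 1.4 and proof of Thm. 1.2.
* J. von zur Gathen, *Permanent and determinant*, Linear Algebra Appl. 96 (1987) 87–100, §2
  (`sing P_n`), cited by ABV for the codimension.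
-/

noncomputable section

open Module

namespace Literature.Computability.AlgebraicComplexity

namespace AlperBogartVelasco

variable {K : Type*} [Field K]

/-! ### Two general lemmas -/

/-- Rank–nullity for the restriction of a linear map to a subspace:
`dim V = dim f(V) + dim (V ∩ ker f)`. [folklore] -/
theorem finrank_eq_finrank_map_add_finrank_inf_ker {E F : Type*} [AddCommGroup E] [Module K E]
    [AddCommGroup F] [Module K F] [FiniteDimensional K E] (V : Submodule K E) (f : E →ₗ[K] F) :
    finrank K V = finrank K (V.map f) + finrank K (V ⊓ LinearMap.ker f : Submodule K E) := by
  have h := LinearMap.finrank_range_add_finrank_ker (f.domRestrict V)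
  rw [LinearMap.range_domRestrict, LinearMap.ker_domRestrict] at h
  have hc : (LinearMap.ker f).comap V.subtype = (V ⊓ LinearMap.ker f).comap V.subtype := by
    ext ⟨x, hx⟩
    simp
  rw [hc] at h
  rw [← h, (Submodule.comapSubtypeEquivOfLe (inf_le_left : V ⊓ LinearMap.ker f ≤ V)).finrank_eq]

/-- **The key injectivity** (elementary): if `v_{c₀} ≠ 0` and the pairings
`u_{c₀} v_j + u_j v_{c₀}` (`j ≠ c₀`) vanish for all `u` in a subspace `Y`, then `u ↦ u_{c₀}` is
injective on `Y`, so `dim Y ≤ 1`. [folklore] -/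
theorem finrank_le_one_of_pairings {m : ℕ} (Y : Submodule K (Fin m → K)) (v : Fin m → K)
    {c₀ : Fin m} (hv : v c₀ ≠ 0)
    (h : ∀ u ∈ Y, ∀ j, j ≠ c₀ → u c₀ * v j + u j * v c₀ = 0) : finrank K Y ≤ 1 := by
  let f : Y →ₗ[K] K := (LinearMap.proj c₀).comp Y.subtype
  have hker : LinearMap.ker f = ⊥ := by
    refine LinearMap.ker_eq_bot'.2 fun u hu => ?_
    have hc : (u : Fin m → K) c₀ = 0 := hu
    have hzero : (u : Fin m → K) = 0 := by
      funext j
      by_cases hj : j = c₀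
      · rw [hj, hc, Pi.zero_apply]
      · have e := h u u.2 j hj
        rw [hc, zero_mul, zero_add] at e
        exact (mul_eq_zero.1 e).resolve_right hv
    exact Subtype.ext hzero
  have hfin := LinearMap.finrank_le_finrank_of_injective (LinearMap.ker_eq_bot.1 hker)
  rwa [Module.finrank_self] at hfin

/-! ### The `3 × 3` case -/

/-- The ordered pairs of distinct elements of `Fin 3`. [folklore] -/
theorem fin_three_pairs (a b : Fin 3) (h : b ≠ a) :
    (a = 0 ∧ b = 1) ∨ (a = 0 ∧ b = 2) ∨ (a = 1 ∧ b = 0) ∨ (a = 1 ∧ b = 2) ∨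
      (a = 2 ∧ b = 0) ∨ (a = 2 ∧ b = 1) := by
  revert a b; decide

/-- From the three `2 × 2` pairings of two vectors of `K³` to the form consumed by
`finrank_le_one_of_pairings`. [folklore] -/
theorem pairings_of_three {u v : Fin 3 → K} (h01 : u 0 * v 1 + u 1 * v 0 = 0)
    (h02 : u 0 * v 2 + u 2 * v 0 = 0) (h12 : u 1 * v 2 + u 2 * v 1 = 0) :
    ∀ c₀ j : Fin 3, j ≠ c₀ → u c₀ * v j + u j * v c₀ = 0 := by
  intro c₀ j hj
  rcases fin_three_pairs c₀ j hj with ⟨rfl, rfl⟩ | ⟨rfl, rfl⟩ | ⟨rfl, rfl⟩ | ⟨rfl, rfl⟩ |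
    ⟨rfl, rfl⟩ | ⟨rfl, rfl⟩
  · linear_combination h01
  · linear_combination h02
  · linear_combination h01
  · linear_combination h12
  · linear_combination h02
  · linear_combination h12

/-- The arithmetic of the final count: three numbers `≤ 3`, of which any one that is `≥ 1`
forces every other to be `≤ 1`, sum to at most `3`. [folklore] -/
theorem sum_le_three_of_pairwise (n : Fin 3 → ℕ) (hle : ∀ i, n i ≤ 3)
    (hPL : ∀ p q, p ≠ q → 1 ≤ n q → n p ≤ 1) : n 0 + n 1 + n 2 ≤ 3 := by
  by_cases hall : ∀ i, n i ≤ 1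
  · have := hall 0; have := hall 1; have := hall 2; omega
  · push Not at hall
    obtain ⟨p, hp⟩ := hall
    have hq : ∀ q, q ≠ p → n q = 0 := fun q hqp => by
      by_contra hne
      have := hPL p q (Ne.symm hqp) (by omega)
      omega
    have h3 := hle p
    have hcases : ∀ i : Fin 3, i = 0 ∨ i = 1 ∨ i = 2 := by decide
    rcases hcases p with rfl | rfl | rfl
    · have := hq 1 (by decide); have := hq 2 (by decide); omega
    · have := hq 0 (by decide); have := hq 2 (by decide); omega
    · have := hq 0 (by decide); have := hq 1 (by decide); omega

/-- **Linear spaces of `3 × 3` matrices with vanishing `2 × 2` subpermanents have dimension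
`≤ 3`** — the elementary replacement, restricted to linear spaces, of
"`codim Sing(perm_3) = 6`" in ABV's deduction of Cor. 1.4 from Thm. 1.2 (the maximum `3` is
attained by the matrices supported on one row).  The hypothesis lists the nine `2 × 2`
subpermanents as the permanents of the submatrices deleting row `r` and column `c`.
[cite: AlperBogartVelasco2017, Cor. 1.4] -/
theorem finrank_le_three_of_subperm_two_vanish (W : Submodule K (Fin 3 × Fin 3 → K))
    (hW : ∀ x ∈ W, ∀ r c : Fin 3,
      ((Matrix.of fun i j => x (i, j)).submatrix r.succAbove c.succAbove).permanent = 0) :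
    finrank K W ≤ 3 := by
  -- the vanishing quadrics, written out: rows `p < q` (complement of `r`), column pairs
  have e00 : (0 : Fin 3).succAbove 0 = 1 := by decide
  have e01 : (0 : Fin 3).succAbove 1 = 2 := by decide
  have e10 : (1 : Fin 3).succAbove 0 = 0 := by decide
  have e11 : (1 : Fin 3).succAbove 1 = 2 := by decide
  have e20 : (2 : Fin 3).succAbove 0 = 0 := by decide
  have e21 : (2 : Fin 3).succAbove 1 = 1 := by decide
  have hQ : ∀ x ∈ W, ∀ r : Fin 3,
      x (r.succAbove 0, 1) * x (r.succAbove 1, 2) + x (r.succAbove 0, 2) * x (r.succAbove 1, 1) = 0 ∧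
      x (r.succAbove 0, 0) * x (r.succAbove 1, 2) + x (r.succAbove 0, 2) * x (r.succAbove 1, 0) = 0 ∧
      x (r.succAbove 0, 0) * x (r.succAbove 1, 1) + x (r.succAbove 0, 1) * x (r.succAbove 1, 0) = 0 := by
    intro x hx r
    have h0 := hW x hx r 0
    have h1 := hW x hx r 1
    have h2 := hW x hx r 2
    rw [Matrix.permanent_fin_two_row] at h0 h1 h2
    simp only [Matrix.submatrix_apply, Matrix.of_apply, e00, e01, e10, e11, e20, e21] at h0 h1 h2
    exact ⟨h0, h1, h2⟩
  -- rows as linear maps and the flag `V₀ ≤ V₁ ≤ W`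
  let ρ : Fin 3 → (Fin 3 × Fin 3 → K) →ₗ[K] (Fin 3 → K) :=
    fun r => LinearMap.funLeft K K fun j => (r, j)
  have hρ : ∀ r x j, ρ r x j = x (r, j) := fun _ _ _ => rfl
  let V₁ : Submodule K (Fin 3 × Fin 3 → K) := W ⊓ LinearMap.ker (ρ 2)
  let V₀ : Submodule K (Fin 3 × Fin 3 → K) := V₁ ⊓ LinearMap.ker (ρ 1)
  let Y : Fin 3 → Submodule K (Fin 3 → K) := ![V₀.map (ρ 0), V₁.map (ρ 1), W.map (ρ 2)]
  have hY0 : Y 0 = V₀.map (ρ 0) := rfl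
  have hY1 : Y 1 = V₁.map (ρ 1) := rfl
  have hY2 : Y 2 = W.map (ρ 2) := rfl
  -- dimension count along the flag
  have hdim : finrank K W = finrank K (Y 0) + finrank K (Y 1) + finrank K (Y 2) := by
    have hbot : (V₀ ⊓ LinearMap.ker (ρ 0) : Submodule K _) = ⊥ := by
      rw [eq_bot_iff]
      intro x hx
      simp only [V₀, V₁, Submodule.mem_inf, LinearMap.mem_ker] at hx
      obtain ⟨⟨⟨-, h2⟩, h1⟩, h0⟩ := hx
      rw [Submodule.mem_bot]
      funext ⟨i, j⟩
      have hcases : ∀ i : Fin 3, i = 0 ∨ i = 1 ∨ i = 2 := by decide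
      rcases hcases i with rfl | rfl | rfl
      · exact congr_fun h0 j
      · exact congr_fun h1 j
      · exact congr_fun h2 j
    rw [hY0, hY1, hY2, finrank_eq_finrank_map_add_finrank_inf_ker W (ρ 2),
      finrank_eq_finrank_map_add_finrank_inf_ker V₁ (ρ 1),
      finrank_eq_finrank_map_add_finrank_inf_ker V₀ (ρ 0), hbot, finrank_bot]
    ring
  -- membership unpacking
  have memV₁ : ∀ x ∈ V₁, x ∈ W ∧ ∀ j, x (2, j) = 0 := fun x hx => by
    simp only [V₁, Submodule.mem_inf, LinearMap.mem_ker] at hx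
    exact ⟨hx.1, fun j => congr_fun hx.2 j⟩
  have memV₀ : ∀ x ∈ V₀, x ∈ W ∧ (∀ j, x (1, j) = 0) ∧ ∀ j, x (2, j) = 0 := fun x hx => by
    simp only [V₀, V₁, Submodule.mem_inf, LinearMap.mem_ker] at hx
    exact ⟨hx.1.1, fun j => congr_fun hx.2 j, fun j => congr_fun hx.1.2 j⟩
  -- the three pairings between the pieces of the flag (polarisation of the quadrics)
  have hP01 : ∀ u ∈ Y 0, ∀ v ∈ Y 1,
      u 0 * v 1 + u 1 * v 0 = 0 ∧ u 0 * v 2 + u 2 * v 0 = 0 ∧ u 1 * v 2 + u 2 * v 1 = 0 := by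
    intro u hu v hv
    rw [hY0, Submodule.mem_map] at hu
    rw [hY1, Submodule.mem_map] at hv
    obtain ⟨x, hx, rfl⟩ := hu
    obtain ⟨x', hx', rfl⟩ := hv
    obtain ⟨hxW, hx1, hx2⟩ := memV₀ x hx
    obtain ⟨hx'W, hx'2⟩ := memV₁ x' hx'
    obtain ⟨a1, a2, a3⟩ := hQ (x + x') (W.add_mem hxW hx'W) 2
    obtain ⟨b1, b2, b3⟩ := hQ x' hx'W 2
    simp only [Pi.add_apply, e20, e21, hρ] at a1 a2 a3 b1 b2 b3 ⊢
    refine ⟨?_, ?_, ?_⟩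
    · linear_combination a3 - b3 - (x (0, 0) + x' (0, 0)) * hx1 1 - (x (0, 1) + x' (0, 1)) * hx1 0
    · linear_combination a2 - b2 - (x (0, 0) + x' (0, 0)) * hx1 2 - (x (0, 2) + x' (0, 2)) * hx1 0
    · linear_combination a1 - b1 - (x (0, 1) + x' (0, 1)) * hx1 2 - (x (0, 2) + x' (0, 2)) * hx1 1
  have hP02 : ∀ u ∈ Y 0, ∀ v ∈ Y 2,
      u 0 * v 1 + u 1 * v 0 = 0 ∧ u 0 * v 2 + u 2 * v 0 = 0 ∧ u 1 * v 2 + u 2 * v 1 = 0 := by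
    intro u hu v hv
    rw [hY0, Submodule.mem_map] at hu
    rw [hY2, Submodule.mem_map] at hv
    obtain ⟨x, hx, rfl⟩ := hu
    obtain ⟨x', hx'W, rfl⟩ := hv
    obtain ⟨hxW, hx1, hx2⟩ := memV₀ x hx
    obtain ⟨a1, a2, a3⟩ := hQ (x + x') (W.add_mem hxW hx'W) 1
    obtain ⟨b1, b2, b3⟩ := hQ x' hx'W 1
    simp only [Pi.add_apply, e10, e11, hρ] at a1 a2 a3 b1 b2 b3 ⊢
    refine ⟨?_, ?_, ?_⟩
    · linear_combination a3 - b3 - (x (0, 0) + x' (0, 0)) * hx2 1 - (x (0, 1) + x' (0, 1)) * hx2 0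
    · linear_combination a2 - b2 - (x (0, 0) + x' (0, 0)) * hx2 2 - (x (0, 2) + x' (0, 2)) * hx2 0
    · linear_combination a1 - b1 - (x (0, 1) + x' (0, 1)) * hx2 2 - (x (0, 2) + x' (0, 2)) * hx2 1
  have hP12 : ∀ u ∈ Y 1, ∀ v ∈ Y 2,
      u 0 * v 1 + u 1 * v 0 = 0 ∧ u 0 * v 2 + u 2 * v 0 = 0 ∧ u 1 * v 2 + u 2 * v 1 = 0 := by
    intro u hu v hv
    rw [hY1, Submodule.mem_map] at hu
    rw [hY2, Submodule.mem_map] at hv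
    obtain ⟨x, hx, rfl⟩ := hu
    obtain ⟨x', hx'W, rfl⟩ := hv
    obtain ⟨hxW, hx2⟩ := memV₁ x hx
    obtain ⟨a1, a2, a3⟩ := hQ (x + x') (W.add_mem hxW hx'W) 0
    obtain ⟨b1, b2, b3⟩ := hQ x' hx'W 0
    simp only [Pi.add_apply, e00, e01, hρ] at a1 a2 a3 b1 b2 b3 ⊢
    refine ⟨?_, ?_, ?_⟩
    · linear_combination a3 - b3 - (x (1, 0) + x' (1, 0)) * hx2 1 - (x (1, 1) + x' (1, 1)) * hx2 0
    · linear_combination a2 - b2 - (x (1, 0) + x' (1, 0)) * hx2 2 - (x (1, 2) + x' (1, 2)) * hx2 0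
    · linear_combination a1 - b1 - (x (1, 1) + x' (1, 1)) * hx2 2 - (x (1, 2) + x' (1, 2)) * hx2 1
  -- all ordered pairs
  have hP : ∀ p q : Fin 3, q ≠ p → ∀ u ∈ Y p, ∀ v ∈ Y q,
      u 0 * v 1 + u 1 * v 0 = 0 ∧ u 0 * v 2 + u 2 * v 0 = 0 ∧ u 1 * v 2 + u 2 * v 1 = 0 := by
    have hsymm : ∀ u v : Fin 3 → K,
        (u 0 * v 1 + u 1 * v 0 = 0 ∧ u 0 * v 2 + u 2 * v 0 = 0 ∧ u 1 * v 2 + u 2 * v 1 = 0) →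
        (v 0 * u 1 + v 1 * u 0 = 0 ∧ v 0 * u 2 + v 2 * u 0 = 0 ∧ v 1 * u 2 + v 2 * u 1 = 0) := by
      rintro u v ⟨h1, h2, h3⟩
      exact ⟨by linear_combination h1, by linear_combination h2, by linear_combination h3⟩
    intro p q hpq u hu v hv
    rcases fin_three_pairs p q hpq with ⟨rfl, rfl⟩ | ⟨rfl, rfl⟩ | ⟨rfl, rfl⟩ | ⟨rfl, rfl⟩ |
      ⟨rfl, rfl⟩ | ⟨rfl, rfl⟩
    · exact hP01 u hu v hv
    · exact hP02 u hu v hv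
    · exact hsymm v u (hP01 v hv u hu)
    · exact hP12 u hu v hv
    · exact hsymm v u (hP02 v hv u hu)
    · exact hsymm v u (hP12 v hv u hu)
  -- the count
  have hle : ∀ i, finrank K (Y i) ≤ 3 := fun i =>
    ((Y i).finrank_le).trans (by rw [finrank_fintype_fun_eq_card, Fintype.card_fin])
  have hPL : ∀ p q, p ≠ q → 1 ≤ finrank K (Y q) → finrank K (Y p) ≤ 1 := by
    intro p q hpq hq
    have hne : Y q ≠ ⊥ := fun h => by rw [h, finrank_bot] at hq; exact absurd hq (by decide)
    obtain ⟨v, hv, hv0⟩ := Submodule.exists_mem_ne_zero_of_ne_bot hne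
    obtain ⟨c₀, hc₀⟩ : ∃ c₀, v c₀ ≠ 0 := by
      by_contra hall
      push Not at hall
      exact hv0 (funext hall)
    refine finrank_le_one_of_pairings (Y p) v hc₀ fun u hu => ?_
    obtain ⟨h1, h2, h3⟩ := hP p q (Ne.symm hpq) u hu v hv
    exact pairings_of_three h1 h2 h3 c₀
  rw [hdim]
  exact sum_le_three_of_pairwise (fun i => finrank K (Y i)) hle hPL

end AlperBogartVelasco

end Literature.Computability.AlgebraicComplexity
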